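import Mathlib
import Summits.NavierStokesRegularity.NavierStokesRegularity.Theorems.EulerZoomLiouvillePowerGaugeEulerLiouvilleTransportShellLaw

/-!
# R50 plate: LOW-REGION MONOTONICITY — the SIGNED member of the α-family
# (nsreg-p2 ROUND-50 «THE WALL COMES FOR FREE» §4, `NsregP2.R50.LowRegionMonotone γ α`, text VERBATIM from `r50/Sketch50.lean`
# 6c31f8f6e879902e with `selfSimilarTransport` / `modPressure` UNFOLDED; seat ns-ezl-w2 g6, `--supports stmt-NavierStokesRegularity-19832 --as helper`)

For `α ∈ [−1, 1]`: if the Bernoulli function `ℋ = ½‖W‖² + Π` is `≤ h` on the closed shell `r₁ ≤ ‖y − x₀‖ ≤ r₂` (`0 < r₁ < r₂`), then with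
`S(r) = sphereIntegral(W_n² + Π)(r)`,
`r₂^{3−α}(S(r₂) − 4πh) − 4πγ(5γ−1)r₂^{5−α}/(5−α) ≤ r₁^{3−α}(S(r₁) − 4πh) − 4πγ(5γ−1)r₁^{5−α}/(5−α)`.
Proof: `transportShellLaw` (Chae–Wolf (2.8) in transport variables, `…TransportShellLaw`); on the shell the integrand is
`‖z‖^{−α}((3−α)ℋ + ((α−1)/2)‖W‖² − αW_n² + γ(5γ−1)‖z‖²)` and `((α−1)/2)‖W‖² − αW_n² = −((1−α)/2)(‖W‖² − W_n²) − ((1+α)/2)W_n² ≤ 0`,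
so it is `≤ ‖z‖^{−α}((3−α)h + γ(5γ−1)‖z‖²)`, whose shell integral is `4πh(r₂^{3−α} − r₁^{3−α}) + 4πγ(5γ−1)(r₂^{5−α} − r₁^{5−α})/(5−α)`
(polar coordinates on the shell + FTC for `t^{3−α}`, `t^{5−α}`).

HONEST FRAMING: a ROUND-50 instrument inequality (class-free; the Bernoulli-low hypothesis is an input, nothing is claimed about where it
holds); nothing about the crux E (19832 OPEN) or NS regularity. [cite: ChaeWolf2016, Remark 2.3 (2.8)] [folklore]
-/

noncomputable section

set_option linter.dupNamespace false

open MeasureTheory Set Filter Topology Metric Function TopologicalSpace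
open scoped ENNReal NNReal RealInnerProductSpace Topology

namespace Summit.NavierStokesRegularity.NavierStokesRegularity.Theorems.PowerGaugeEulerLiouville

open Literature.Analysis Literature.Analysis.FunctionSpaces Literature.Analysis.FluidPDE

namespace ClassicalProfile

/-! ## Radial integrands on shells -/

/-- `‖y − x₀‖^{−α}·g(‖y − x₀‖)` (`g` continuous) is integrable on the shell `B_{r₂}(x₀) ∖ B_{r₁}(x₀)`, `0 < r₁`. [folklore] -/
theorem integrableOn_shell_rpow_mul_radial {g : ℝ → ℝ} (hg : Continuous g) (x₀ : EuclideanSpace ℝ (Fin 3)) (α : ℝ) {r₁ : ℝ}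
    (hr₁ : 0 < r₁) (r₂ : ℝ) :
    IntegrableOn (fun y : EuclideanSpace ℝ (Fin 3) => ‖y - x₀‖ ^ (-α) * g ‖y - x₀‖) (ball x₀ r₂ \ ball x₀ r₁) := by
  have hK : IsCompact (closedBall x₀ r₂ \ ball x₀ r₁) := (isCompact_closedBall x₀ r₂).diff isOpen_ball
  refine (ContinuousOn.integrableOn_compact hK ?_).mono_set fun y hy => ⟨ball_subset_closedBall hy.1, hy.2⟩
  intro y hy
  have hn : ‖y - x₀‖ ≠ 0 := by
    intro h0
    have : y ∈ ball x₀ r₁ := by rw [mem_ball, dist_eq_norm, h0]; exact hr₁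
    exact hy.2 this
  exact ((((continuous_id.sub continuous_const).norm.continuousAt).rpow_const (Or.inl hn)).mul
    ((hg.comp (continuous_id.sub continuous_const).norm).continuousAt)).continuousWithinAt

/-- **Radial shell integrals**: `(k + 3 − α)·∫_{B_{r₂}(x₀)∖B_{r₁}(x₀)} ‖z‖^{−α}‖z‖^k = 4π(r₂^{k+3−α} − r₁^{k+3−α})` for `0 < r₁ < r₂`
(polar coordinates + FTC for `t^{k+3−α}`; uniform in `α`). [folklore] -/
theorem shell_rpow_moment (x₀ : EuclideanSpace ℝ (Fin 3)) (α : ℝ) (k : ℕ) {r₁ r₂ : ℝ} (hr₁ : 0 < r₁) (h12 : r₁ < r₂) :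
    ((k : ℝ) + 3 - α) * ∫ y in ball x₀ r₂ \ ball x₀ r₁, ‖y - x₀‖ ^ (-α) * ‖y - x₀‖ ^ k
      = 4 * Real.pi * (r₂ ^ ((k : ℝ) + 3 - α) - r₁ ^ ((k : ℝ) + 3 - α)) := by
  have hpos : ∀ t ∈ uIcc r₁ r₂, 0 < t := by
    intro t ht
    rw [uIcc_of_le h12.le] at ht
    exact hr₁.trans_le ht.1
  rw [setIntegral_shell_eq_intervalIntegral_sphereIntegral
    (integrableOn_shell_rpow_mul_radial (continuous_pow k) x₀ α hr₁ r₂) hr₁ h12.le]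
  have hrad : ∀ t ∈ uIcc r₁ r₂, t ^ 2 * sphereIntegral volume
      (fun z : EuclideanSpace ℝ (Fin 3) => ‖z + x₀ - x₀‖ ^ (-α) * ‖z + x₀ - x₀‖ ^ k) t = 4 * Real.pi * t ^ ((k : ℝ) + 2 - α) := by
    intro t ht
    have ht0 := hpos t ht
    simp only [add_sub_cancel_right]
    rw [sphereIntegral_radial_fun (fun s : ℝ => s ^ (-α) * s ^ k) ht0.le]
    have e : t ^ 2 * (t ^ (-α) * t ^ k) = t ^ ((k : ℝ) + 2 - α) := by
      rw [← Real.rpow_natCast t 2, ← Real.rpow_natCast t k, ← Real.rpow_add ht0, ← Real.rpow_add ht0]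
      ring_nf
    rw [show t ^ 2 * (4 * Real.pi * (t ^ (-α) * t ^ k)) = 4 * Real.pi * (t ^ 2 * (t ^ (-α) * t ^ k)) by ring, e]
  rw [intervalIntegral.integral_congr hrad, intervalIntegral.integral_const_mul]
  have hderiv : ∀ t ∈ uIcc r₁ r₂, HasDerivAt (fun t : ℝ => t ^ ((k : ℝ) + 3 - α)) (((k : ℝ) + 3 - α) * t ^ ((k : ℝ) + 2 - α)) t := by
    intro t ht
    have hd := Real.hasDerivAt_rpow_const (p := (k : ℝ) + 3 - α) (Or.inl (hpos t ht).ne')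
    rwa [show (k : ℝ) + 3 - α - 1 = (k : ℝ) + 2 - α by ring] at hd
  have hcont : ContinuousOn (fun t : ℝ => ((k : ℝ) + 3 - α) * t ^ ((k : ℝ) + 2 - α)) (uIcc r₁ r₂) :=
    continuousOn_const.mul (continuousOn_id.rpow_const fun t ht => Or.inl (hpos t ht).ne')
  have hFTC := intervalIntegral.integral_eq_sub_of_hasDerivAt hderiv hcont.intervalIntegrable
  rw [intervalIntegral.integral_const_mul] at hFTC
  linear_combination 4 * Real.pi * hFTC

/-! ## Low-region monotonicity -/

/-- **LOW-REGION MONOTONICITY** (`NsregP2.R50.LowRegionMonotone γ α`, text verbatim with `selfSimilarTransport`/`modPressure` unfolded):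
see the module docstring. [cite: ChaeWolf2016, Remark 2.3 (2.8)] [folklore] -/
theorem lowRegionMonotone (γ α : ℝ) :
    -1 ≤ α → α ≤ 1 →
    ∀ (c : EuclideanSpace ℝ (Fin 3)) (V : EuclideanSpace ℝ (Fin 3) → EuclideanSpace ℝ (Fin 3)) (P : EuclideanSpace ℝ (Fin 3) → ℝ),
      IsSelfSimilarEulerProfile γ c V P →
      ∀ (x₀ : EuclideanSpace ℝ (Fin 3)) (r₁ r₂ h : ℝ), 0 < r₁ → r₁ < r₂ →
        (∀ y, r₁ ≤ ‖y - x₀‖ → ‖y - x₀‖ ≤ r₂ → selfSimilarBernoulli γ c V P y ≤ h) →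
          r₂ ^ (3 - α) * (sphereIntegral volume
                (fun z : EuclideanSpace ℝ (Fin 3) => ⟪γ • (z + x₀ - c) + V (z + x₀), z⟫ ^ 2 / ‖z‖ ^ 2
                  + (P (z + x₀) - γ * (1 - γ) / 2 * ‖z + x₀ - c‖ ^ 2)) r₂
                - 4 * Real.pi * h)
              - 4 * Real.pi * γ * (5 * γ - 1) / (5 - α) * r₂ ^ (5 - α)
            ≤ r₁ ^ (3 - α) * (sphereIntegral volume
                (fun z : EuclideanSpace ℝ (Fin 3) => ⟪γ • (z + x₀ - c) + V (z + x₀), z⟫ ^ 2 / ‖z‖ ^ 2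
                  + (P (z + x₀) - γ * (1 - γ) / 2 * ‖z + x₀ - c‖ ^ 2)) r₁
                - 4 * Real.pi * h)
              - 4 * Real.pi * γ * (5 * γ - 1) / (5 - α) * r₁ ^ (5 - α) := by
  intro hα₁ hα₂ c V P hprof x₀ r₁ r₂ h hr₁ h12 hH
  have hr₂ : 0 < r₂ := hr₁.trans h12
  have h5 : (5 : ℝ) - α ≠ 0 := by intro h0; linarith
  have hV : Continuous V := hprof.contDiff_velocity.continuous
  have hP : Continuous P := hprof.contDiff_pressure.continuous
  have hWc : Continuous fun y : EuclideanSpace ℝ (Fin 3) => γ • (y - c) + V y := by fun_prop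
  have hPhc : Continuous fun y : EuclideanSpace ℝ (Fin 3) =>
      P y - γ * (1 - γ) / 2 * ‖y - c‖ ^ 2 - γ * (5 * γ - 1) / 2 * ‖y - x₀‖ ^ 2 := by fun_prop
  -- the transport shell law
  have hTSL := transportShellLaw γ α c V P hprof x₀ r₁ r₂ hr₁ h12
  -- integrability of the shell-law integrand and of the majorant
  have hIhat := integrableOn_shell_rpow_integrand hWc hPhc x₀ α hr₁ r₂
  have hIrad2 := integrableOn_shell_rpow_mul_radial (continuous_pow 2) x₀ α hr₁ r₂
  have hIrad0 := integrableOn_shell_rpow_mul_radial (continuous_const (y := (1 : ℝ))) x₀ α hr₁ r₂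
  have hIT : IntegrableOn (fun y : EuclideanSpace ℝ (Fin 3) => ‖y - x₀‖ ^ (-α) *
      (‖γ • (y - c) + V y‖ ^ 2 - α * (⟪γ • (y - c) + V y, y - x₀⟫ ^ 2 / ‖y - x₀‖ ^ 2) + (3 - α) * (P y - γ * (1 - γ) / 2 * ‖y - c‖ ^ 2) + γ * (5 * γ - 1) * ‖y - x₀‖ ^ 2))
      (ball x₀ r₂ \ ball x₀ r₁) := by
    refine IntegrableOn.congr_fun (hIhat.add (hIrad2.const_mul ((5 - α) * (γ * (5 * γ - 1) / 2)))) (fun y _ => ?_)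
      (measurableSet_ball.diff measurableSet_ball)
    simp only [Pi.add_apply]
    ring
  have hIB : IntegrableOn (fun y : EuclideanSpace ℝ (Fin 3) => ‖y - x₀‖ ^ (-α) * ((3 - α) * h + γ * (5 * γ - 1) * ‖y - x₀‖ ^ 2))
      (ball x₀ r₂ \ ball x₀ r₁) := by
    refine IntegrableOn.congr_fun ((hIrad0.const_mul ((3 - α) * h)).add (hIrad2.const_mul (γ * (5 * γ - 1))))
      (fun y _ => ?_) (measurableSet_ball.diff measurableSet_ball)
    simp only [Pi.add_apply]
    ring
  -- the pointwise sign argument on the shell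
  have hmono : ∫ y in ball x₀ r₂ \ ball x₀ r₁, ‖y - x₀‖ ^ (-α) *
        (‖γ • (y - c) + V y‖ ^ 2 - α * (⟪γ • (y - c) + V y, y - x₀⟫ ^ 2 / ‖y - x₀‖ ^ 2) + (3 - α) * (P y - γ * (1 - γ) / 2 * ‖y - c‖ ^ 2) + γ * (5 * γ - 1) * ‖y - x₀‖ ^ 2)
      ≤ ∫ y in ball x₀ r₂ \ ball x₀ r₁, ‖y - x₀‖ ^ (-α) * ((3 - α) * h + γ * (5 * γ - 1) * ‖y - x₀‖ ^ 2) := by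
    refine setIntegral_mono_on hIT hIB (measurableSet_ball.diff measurableSet_ball) fun y hy => ?_
    have hy1 : r₁ ≤ ‖y - x₀‖ := by
      have h2 : y ∉ ball x₀ r₁ := hy.2
      rw [mem_ball, dist_eq_norm, not_lt] at h2
      exact h2
    have hy2 : ‖y - x₀‖ ≤ r₂ := by
      have h1 : y ∈ ball x₀ r₂ := hy.1
      rw [mem_ball, dist_eq_norm] at h1
      exact h1.le
    have hHy := hH y hy1 hy2
    rw [selfSimilarBernoulli_apply] at hHy
    have hN0 : 0 ≤ ⟪γ • (y - c) + V y, y - x₀⟫ ^ 2 / ‖y - x₀‖ ^ 2 := div_nonneg (sq_nonneg _) (sq_nonneg _)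
    have hN1 : ⟪γ • (y - c) + V y, y - x₀⟫ ^ 2 / ‖y - x₀‖ ^ 2 ≤ ‖γ • (y - c) + V y‖ ^ 2 := by
      rw [div_le_iff₀ (pow_pos (hr₁.trans_le hy1) 2)]
      have hcs := abs_real_inner_le_norm (γ • (y - c) + V y) (y - x₀)
      have h0 : 0 ≤ |⟪γ • (y - c) + V y, y - x₀⟫| := abs_nonneg _
      nlinarith [sq_abs ⟪γ • (y - c) + V y, y - x₀⟫, norm_nonneg (γ • (y - c) + V y), norm_nonneg (y - x₀),
        mul_nonneg (norm_nonneg (γ • (y - c) + V y)) (norm_nonneg (y - x₀))]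
    have hsign : ‖γ • (y - c) + V y‖ ^ 2 - α * (⟪γ • (y - c) + V y, y - x₀⟫ ^ 2 / ‖y - x₀‖ ^ 2) + (3 - α) * (P y - γ * (1 - γ) / 2 * ‖y - c‖ ^ 2) ≤ (3 - α) * h := by
      have hdec : ‖γ • (y - c) + V y‖ ^ 2 - α * (⟪γ • (y - c) + V y, y - x₀⟫ ^ 2 / ‖y - x₀‖ ^ 2) + (3 - α) * (P y - γ * (1 - γ) / 2 * ‖y - c‖ ^ 2)
          = (3 - α) * ((1 / 2 : ℝ) * ‖γ • (y - c) + V y‖ ^ 2 + P y + γ * (γ - 1) / 2 * ‖y - c‖ ^ 2)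
            - ((1 - α) / 2 * (‖γ • (y - c) + V y‖ ^ 2 - ⟪γ • (y - c) + V y, y - x₀⟫ ^ 2 / ‖y - x₀‖ ^ 2)
              + (1 + α) / 2 * (⟪γ • (y - c) + V y, y - x₀⟫ ^ 2 / ‖y - x₀‖ ^ 2)) := by
        ring
      rw [hdec]
      have h3 : 0 ≤ 3 - α := by linarith
      have hA : 0 ≤ (1 - α) / 2 * (‖γ • (y - c) + V y‖ ^ 2 - ⟪γ • (y - c) + V y, y - x₀⟫ ^ 2 / ‖y - x₀‖ ^ 2) :=
        mul_nonneg (by linarith) (sub_nonneg.2 hN1)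
      have hB : 0 ≤ (1 + α) / 2 * (⟪γ • (y - c) + V y, y - x₀⟫ ^ 2 / ‖y - x₀‖ ^ 2) := mul_nonneg (by linarith) hN0
      nlinarith [mul_le_mul_of_nonneg_left hHy h3]
    have hw : 0 ≤ ‖y - x₀‖ ^ (-α) := Real.rpow_nonneg (norm_nonneg _) _
    have := mul_le_mul_of_nonneg_left hsign hw
    nlinarith [this]
  -- the radial shell integrals
  have hsplit : ∫ y in ball x₀ r₂ \ ball x₀ r₁, ‖y - x₀‖ ^ (-α) * ((3 - α) * h + γ * (5 * γ - 1) * ‖y - x₀‖ ^ 2)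
      = (3 - α) * h * (∫ y in ball x₀ r₂ \ ball x₀ r₁, ‖y - x₀‖ ^ (-α) * (1 : ℝ))
        + γ * (5 * γ - 1) * ∫ y in ball x₀ r₂ \ ball x₀ r₁, ‖y - x₀‖ ^ (-α) * ‖y - x₀‖ ^ 2 := by
    rw [← integral_const_mul, ← integral_const_mul, ← integral_add (hIrad0.const_mul _) (hIrad2.const_mul _)]
    refine integral_congr_ae (ae_of_all _ fun y => ?_)
    ring
  have hI₀ := shell_rpow_moment x₀ α 0 hr₁ h12
  have hI₂ := shell_rpow_moment x₀ α 2 hr₁ h12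
  simp only [pow_zero, CharP.cast_eq_zero, zero_add] at hI₀
  simp only [Nat.cast_ofNat] at hI₂
  norm_num at hI₂
  have hM : ∫ y in ball x₀ r₂ \ ball x₀ r₁, ‖y - x₀‖ ^ (-α) * ‖y - x₀‖ ^ 2
      = 4 * Real.pi * (r₂ ^ (5 - α) - r₁ ^ (5 - α)) / (5 - α) := by
    rw [eq_div_iff h5]
    linear_combination hI₂
  have hI₀' : ∫ y in ball x₀ r₂ \ ball x₀ r₁, ‖y - x₀‖ ^ (-α) * (1 : ℝ)
      = 4 * Real.pi * (r₂ ^ (3 - α) - r₁ ^ (3 - α)) / (3 - α) := by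
    have h3 : (3 : ℝ) - α ≠ 0 := by intro h0; linarith
    rw [eq_div_iff h3]
    linear_combination hI₀
  -- assemble
  rw [hsplit] at hmono
  have eI : (3 - α) * h * (∫ y in ball x₀ r₂ \ ball x₀ r₁, ‖y - x₀‖ ^ (-α) * (1 : ℝ))
      = 4 * Real.pi * h * (r₂ ^ (3 - α) - r₁ ^ (3 - α)) := by
    linear_combination h * hI₀
  have hfin : r₂ ^ (3 - α) * sphereIntegral volume
          (fun z : EuclideanSpace ℝ (Fin 3) => ⟪γ • (z + x₀ - c) + V (z + x₀), z⟫ ^ 2 / ‖z‖ ^ 2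
            + (P (z + x₀) - γ * (1 - γ) / 2 * ‖z + x₀ - c‖ ^ 2)) r₂
        - r₁ ^ (3 - α) * sphereIntegral volume
          (fun z : EuclideanSpace ℝ (Fin 3) => ⟪γ • (z + x₀ - c) + V (z + x₀), z⟫ ^ 2 / ‖z‖ ^ 2
            + (P (z + x₀) - γ * (1 - γ) / 2 * ‖z + x₀ - c‖ ^ 2)) r₁
      ≤ 4 * Real.pi * h * (r₂ ^ (3 - α) - r₁ ^ (3 - α))
        + γ * (5 * γ - 1) * (4 * Real.pi * (r₂ ^ (5 - α) - r₁ ^ (5 - α)) / (5 - α)) := by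
    rw [hTSL, ← eI, ← hM]
    exact hmono
  linear_combination hfin

end ClassicalProfile

end Summit.NavierStokesRegularity.NavierStokesRegularity.Theorems.PowerGaugeEulerLiouville

end
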